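import Mathlib
import Summits.ValiantsHypothesis.ValiantsHypothesis.Theses.GeneratorObstructions

/-!
# Birth skeleton for the piece K1 = `GeneratorObstructions.PerGenDegreeSuperQP` (stmt-ValiantsHypothesis-11654)
# — line `per-side-atoms` (crux-strategist BC3 skeleton for the split `GenFlipThesis ⇐ K1 ∧ K2`, 2026-08-17)

K1 says: for every `c, m₀` there are `m ≥ m₀` and a weight `χ` of `GL_{m²}` with `γ_χ(per_m) ≠ 0`
(a minimal generator of the algebra `A(Δ_m[per_m]) = ⊕_χ HWV_χ(ℂ[Δ_m[per_m]])` of highest-weight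
vectors, per_m in its own `m²` lexicographically ordered variables) of degree
`-|χ|/m > 2^((log₂ m + c)^c)`.

**Lever (strengthen, combinatorial form).** The OCCURRENCE MONOID
`S(per_m) = {χ : HWV_χ(ℂ[Δ_m[per_m]]) ≠ 0}` is a finitely generated submonoid of the weight lattice
(semigroup property: products of highest-weight vectors; finite generation of `A`), generated exactly by
the generator TYPES; hence its ATOMS (occurring `χ ≠ 0` that are not `χ₁ + χ₂` with both `χᵢ`
occurring and nonzero) are generator types: at an atom the decomposable part
`Σ_{χ₁+χ₂=χ} HWV_χ₁ · HWV_χ₂` vanishes identically, so `γ_χ = dim HWV_χ ≥ 1` with NO dimension count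
modulo products (`stub_atomGen`, provable now).  K1 then follows from LATE ATOMS (`stub_atomLate`):
the occurrence monoid of the permanent keeps acquiring indecomposable elements beyond every
quasi-polynomial degree.  Why easier than K1: atoms are pure occurrence data — the tools of the
occurrence theory apply (semigroup property and inheritance BLMW2011 §5–6, moment polytope / saturation
BurgisserHuttenhainIkenmeyer2017 "not via saturations", explicit highest-weight vectors evaluated at
per as in BurgisserIkenmeyer2017 / DorflerIkenmeyerPanova2020), and small `m` are computable from rank
tests alone.  Why it might fail: saturation-type results (BHI 2017: the saturation of `S(Δ(per))` is
essentially everything) and the `everything eventually occurs' heuristics suggest all atoms of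
`S(per_m)` sit in degree poly(`m`) even if late GENERATORS exist for dimension reasons — then this
line dies and K1 needs the dimension-gap form (lower bound on one multiplicity of the closure versus
stabiliser upper bounds on all its splittings).

**Shape.** Two stubs, `PerGenDegreeSuperQP_of : PerGenDegreeSuperQP` sorry-free from them.
Statements over Mathlib + `Literature.*` + the route file only.
-/

namespace Summit.ValiantsHypothesis.ValiantsHypothesis.Cruxes.GenFlipThesis.PerSideAtoms

open MvPolynomial
open Literature.NumberTheory.DiophantineGeometry Literature.Computability.AlgebraicComplexity
open Summit.ValiantsHypothesis.ValiantsHypothesis.Theses.GeneratorObstructions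

-- `Summit.ValiantsHypothesis.ValiantsHypothesis.…` is the tree's mandated single-conjunct layout.
set_option linter.dupNamespace false

/-- **stub_atomLate** (late atoms of the permanent's occurrence monoid; conjecture-grade, the content):
for every `c, m₀` there are `m ≥ max(m₀,1)` and a weight `χ` OCCURRING in `ℂ[Δ_m[per_m]]`
(`HWV_χ ≠ ⊥`) which is an ATOM — no splitting `χ = χ₁ + χ₂` into two nonzero occurring weights —
of degree `-|χ|/m > 2^((log₂ m + c)^c)`. -/
theorem stub_atomLate :
    ∀ c m₀ : ℕ, ∃ m : ℕ, m₀ ≤ m ∧ 1 ≤ m ∧ ∃ χ : Weight (MatIdx m),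
      highestWeightSpace (orbitCoordRep (MvPolynomial.rename toLex (perPoly (Fin m) ℂ)) m) χ ≠ ⊥ ∧
      (∀ χ₁ χ₂ : Weight (MatIdx m), χ₁ + χ₂ = χ → χ₁ ≠ 0 → χ₂ ≠ 0 →
          highestWeightSpace (orbitCoordRep (MvPolynomial.rename toLex (perPoly (Fin m) ℂ)) m) χ₁ = ⊥ ∨ highestWeightSpace (orbitCoordRep (MvPolynomial.rename toLex (perPoly (Fin m) ℂ)) m) χ₂ = ⊥) ∧
      (m : ℤ) * 2 ^ ((Nat.log 2 m + c) ^ c) < -(Weight.size χ) := by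
  sorry

/-- **stub_atomGen** (atoms are generator types; provable now, size S): for `1 ≤ m`, an occurring
weight `χ` of `ℂ[Δ_m[per_m]]` admitting no splitting into two nonzero occurring weights has
`γ_χ(per_m) ≠ 0`: every summand `HWV_χ₁ · HWV_χ₂` of the decomposable part has a `⊥` factor
(`Submodule.mul_bot` / `Submodule.bot_mul`), so the quotient is `HWV_χ` itself, finite-dimensional for
`m ≠ 0` (`finiteDimensional_highestWeightSpace_orbitCoordRep_holds`) and nonzero. -/
theorem stub_atomGen :
    ∀ m : ℕ, 1 ≤ m → ∀ χ : Weight (MatIdx m), highestWeightSpace (orbitCoordRep (MvPolynomial.rename toLex (perPoly (Fin m) ℂ)) m) χ ≠ ⊥ →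
      (∀ χ₁ χ₂ : Weight (MatIdx m), χ₁ + χ₂ = χ → χ₁ ≠ 0 → χ₂ ≠ 0 →
          highestWeightSpace (orbitCoordRep (MvPolynomial.rename toLex (perPoly (Fin m) ℂ)) m) χ₁ = ⊥ ∨ highestWeightSpace (orbitCoordRep (MvPolynomial.rename toLex (perPoly (Fin m) ℂ)) m) χ₂ = ⊥) →
      Module.finrank ℂ (↥(highestWeightSpace (orbitCoordRep (MvPolynomial.rename toLex (perPoly (Fin m) ℂ)) m) (χ)) ⧸ Submodule.comap (highestWeightSpace (orbitCoordRep (MvPolynomial.rename toLex (perPoly (Fin m) ℂ)) m) (χ)).subtype (⨆ p : Weight (MatIdx (m)) × Weight (MatIdx (m)), ⨆ (_ : p.1 + p.2 = (χ) ∧ p.1 ≠ 0 ∧ p.2 ≠ 0), highestWeightSpace (orbitCoordRep (MvPolynomial.rename toLex (perPoly (Fin m) ℂ)) m) p.1 * highestWeightSpace (orbitCoordRep (MvPolynomial.rename toLex (perPoly (Fin m) ℂ)) m) p.2)) ≠ 0 := by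
  sorry

/-- **K1 from the two stubs**: a late atom (stub 1) is a late generator type (stub 2). -/
theorem PerGenDegreeSuperQP_of : PerGenDegreeSuperQP := by
  intro c m₀
  obtain ⟨m, hm, h1m, χ, hocc, hatom, hdeg⟩ := stub_atomLate c m₀
  exact ⟨m, hm, χ, stub_atomGen m h1m χ hocc hatom, hdeg⟩

end Summit.ValiantsHypothesis.ValiantsHypothesis.Cruxes.GenFlipThesis.PerSideAtoms
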